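import Literature.AnabelianGeometry.EtaleTheta.DivisorMonoidsRootLaw
import Literature.AnabelianGeometry.EtaleTheta.DivisorMonoidsOfGaloisCoveringTempered

/-!
# [EtTh] ERRATUM E2 vs Prop. 3.2 (iii) — F-L2t3g5-1 AT THE MODEL OF RECORD OVER THE GENUINE BASE: the root laws collapse
# also over `DivisorMonoids.ofGaloisActionTempered` (v1 data base-changed to `B^temp(Π)⁰`)

S. Mochizuki, *The étale theta function …*, Publ. RIMS **45** (2009) [MochizukiEtTh2009], §3 Prop. 3.2 (iii) p.70, Def. 3.3
(iii) p.73, Def. 3.6 (ii)(b) p.77, Prop. 4.2 (iii) p.89; ERRATUM E2 = [IUTchI] Rmk. 3.2.4 (i)(a) [cite: MochizukiEtTh2009, Prop 3.2 (iii) p.70].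
abc-iut cell, layer L2; seat abc-iut-L2-t3 (gen 5); sequel of `LogDivisorModelRootLawNoGo.lean` (p447056, label F-L2t3g5-1)
and `DivisorMonoidsRootLaw.lean` (p449939).  PROOF-ONLY (0 defs); nothing landed is edited.

WHY.  p447056 / p449939 state the collapse for tempered Frobenioids over `ofRlfZ(Weak) (ofGaloisActionConnected A hZ) hpf`
(base functor into the connected `G`-sets).  Since abc-iut-L2-lead R398 the MODELS OF RECORD over print's genuine base
are built on abc-iut-w6-d048's `DivisorMonoids.ofGaloisActionTempered A hZ = (ofGaloisAction A hZ).precomp (temperedInclusion Π)`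
(p449586) — a DIFFERENT `DivisorMonoids` term (over `ConnectedPart (BTemp Π)` itself), to which those theorems do not
literally apply.  This file transports the no-go to it (same argument: one value group `Mero(Z_∞)`, covering maps of
connected tempered coverings surjective — `hom_surjective_temperedInclusion`):
* §1 `DivisorMonoids.bZero_eq_one_of_rootLaw_ofGaloisActionTempered` — `RootLaw (ofGaloisActionTempered A hZ)` forces
  `B₀(Y) = 1` for every `Y ∈ B^temp(Π)⁰`;
* §2 for every tempered Frobenioid of monoid type `ℤ` over `ofRlfZWeak (ofGaloisActionTempered A hZ) hpf` resp.
  `ofRlfZ …` (any base category / base functor / `IG`): `BaseRootLaw IG` ⇒ `B₀^ℤ(Y_X) = 1` at every `IG`-object ⇒ `¬ IG X`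
  ⇒ **`not_baseRootLaw_of_exists_tempered(_ofRlfZ)`**, `not_baseRootLaw_top_tempered(_ofRlfZ)`.
So F-L2t3g5-1 covers the tempered models of record (abc-iut-w6-d048's `TemperedFrobenioidOfRankOneBase` lineage) as they
land; the positive route stays the v2 datum (`DivisorMonoids.ofTower`, staged).  HONEST FRAMING: kernel facts about OUR
typed model class; typed ≠ proved; nothing here bears on the disputed [IUTchIII] Cor. 3.12.
-/

noncomputable section

namespace Literature.AnabelianGeometry.EtaleTheta

open CategoryTheory Opposite Function Literature.AlgebraicGeometry.Frobenioids Literature.AnabelianGeometry.SemiGraphs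

universe u u₀ v₀

/-! ### §1 `RootLaw` collapses on the tempered v1 data -/

namespace DivisorMonoids

open LogDivisorModel.GaloisAction

variable {Γ : Type u} [Group Γ] [TopologicalSpace Γ] {Z : LogDivisorModel.{u}} (A : Z.GaloisAction Γ) (hZ : Z.CuspLaws)

/-- Values of an `N`-th root over a covering of connected tempered coverings: every value of `b` is an `N`-th power in
`Mero(Z_∞)`. [cite: MochizukiEtTh2009, Def 3.3 (iii) p.73] -/
theorem exists_pow_eq_apply_ofGaloisActionTempered {Y Y' : ConnectedPart (BTemp Γ)} (f : Y' ⟶ Y) (N : ℕ)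
    (b : (ofGaloisActionTempered A hZ).B₀.obj (op Y)) (r : (ofGaloisActionTempered A hZ).B₀.obj (op Y'))
    (h : r ^ N = ((ofGaloisActionTempered A hZ).B₀.map f.op).hom b) (s : Y.obj.obj.V) :
    ∃ g : Z.Fn, g ^ N = (b : A.bZero Y.obj.obj).1 s := by
  obtain ⟨s', rfl⟩ := hom_surjective_temperedInclusion f s
  refine ⟨(r : A.bZero Y'.obj.obj).1 s', ?_⟩
  exact congrArg (fun x : (ofGaloisActionTempered A hZ).B₀.obj (op Y') => (x : A.bZero Y'.obj.obj).1 s') h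

/-- **F-L2t3g5-1 on the tempered v1 data**: `RootLaw (ofGaloisActionTempered A hZ)` forces `B₀(Y) = 1` for every
connected tempered covering `Y` (Prop. 3.2 (iii) on the single value group). [cite: MochizukiEtTh2009, Prop 3.2 (iii) p.70] -/
theorem bZero_eq_one_of_rootLaw_ofGaloisActionTempered (h : (ofGaloisActionTempered A hZ).RootLaw)
    (Y : ConnectedPart (BTemp Γ)) (b : (ofGaloisActionTempered A hZ).B₀.obj (op Y)) : b = 1 := by
  apply Subtype.ext
  funext s
  apply Z.eq_one_of_forall_exists_pow_eq
  intro N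
  obtain ⟨Y', f, r, hr⟩ := h.exists_root N Y b
  exact exists_pow_eq_apply_ofGaloisActionTempered A hZ f N b r hr s

end DivisorMonoids

/-! ### §2 `BaseRootLaw` refuted for tempered Frobenioids over the tempered v1 data -/

namespace TemperedFrobenioid

open LogDivisorModel.GaloisAction

section Weak

variable {Γ : Type u} [Group Γ] [TopologicalSpace Γ] {Z : LogDivisorModel.{u}} (A : Z.GaloisAction Γ) (hZ : Z.CuspLaws)
  (hpf : ∀ Y : (ConnectedPart (BTemp Γ))ᵒᵖ, IsPerfFactorialCof ((DivisorMonoids.ofGaloisActionTempered A hZ).Φ₀.obj Y))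
  {D : Type u₀} [Category.{v₀} D] {VD : FrdICatStub.{u₀, v₀, u} D}

/-- `BaseRootLaw IG` forces `B₀^ℤ(Y_X) = 1` at every `IG`-object (tempered v1 data, weak vocabulary).
[cite: MochizukiEtTh2009, Prop 3.2 (iii) p.70] -/
theorem bΛ_eq_one_of_baseRootLaw_tempered
    (tf : TemperedFrobenioid (RealifiedDivisorMonoids.ofRlfZWeak (DivisorMonoids.ofGaloisActionTempered A hZ) hpf) D VD)
    (IG : D → Prop) (h : tf.BaseRootLaw IG) (X : D) (hX : IG X)
    (b : (RealifiedDivisorMonoids.ofRlfZWeak (DivisorMonoids.ofGaloisActionTempered A hZ) hpf).BΛ.obj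
      (op (tf.base.obj X))) : b = 1 := by
  apply Subtype.ext
  funext s
  apply Z.eq_one_of_forall_exists_pow_eq
  intro N
  obtain ⟨X', hX', c, b', hb'⟩ := h N X hX b
  exact DivisorMonoids.exists_pow_eq_apply_ofGaloisActionTempered A hZ (tf.base.map c) N b b' hb' s

/-- Hence no `IG`-object exists under `BaseRootLaw IG` (Def. 3.6 (ii)(b) at an `IG`-object + integrality of `Φ₀^rlf`).
[cite: MochizukiEtTh2009, Def 3.6 (ii) p.77] -/
theorem not_isIG_of_baseRootLaw_tempered
    (tf : TemperedFrobenioid (RealifiedDivisorMonoids.ofRlfZWeak (DivisorMonoids.ofGaloisActionTempered A hZ) hpf) D VD)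
    (IG : D → Prop) (h : tf.BaseRootLaw IG) (X : D) : ¬ IG X := by
  intro hX
  obtain ⟨b, -, x, -, y, -, hxy, hdiv⟩ := tf.exists_FΛ_div_ne (op X)
  have hb : b = 1 := bΛ_eq_one_of_baseRootLaw_tempered A hZ hpf tf IG h X hX b
  rw [hb, map_one, eq_comm, div_eq_one] at hdiv
  exact hxy ((IsPerfFactorialWeak.Rlf.isIntegral (hpf (op (tf.base.obj X))).weak).injective_of hdiv)

/-- **A10 `BaseRootLaw` REFUTED over the tempered v1 data as soon as one `IG`-object exists.**
[cite: MochizukiEtTh2009, Prop 4.2 (iii) p.89] -/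
theorem not_baseRootLaw_of_exists_tempered
    (tf : TemperedFrobenioid (RealifiedDivisorMonoids.ofRlfZWeak (DivisorMonoids.ofGaloisActionTempered A hZ) hpf) D VD)
    (IG : D → Prop) (hIG : ∃ X : D, IG X) : ¬ tf.BaseRootLaw IG :=
  fun h => hIG.elim fun X hX => not_isIG_of_baseRootLaw_tempered A hZ hpf tf IG h X hX

/-- In particular for `IG := ⊤`. [cite: MochizukiEtTh2009, Prop 4.2 (iii) p.89] -/
theorem not_baseRootLaw_top_tempered
    (tf : TemperedFrobenioid (RealifiedDivisorMonoids.ofRlfZWeak (DivisorMonoids.ofGaloisActionTempered A hZ) hpf) D VD) :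
    ¬ tf.BaseRootLaw fun _ => True :=
  not_baseRootLaw_of_exists_tempered A hZ hpf tf _ ⟨tf.isConnected.is_nonempty.some, trivial⟩

end Weak

section Strong

variable {Γ : Type u} [Group Γ] [TopologicalSpace Γ] {Z : LogDivisorModel.{u}} (A : Z.GaloisAction Γ) (hZ : Z.CuspLaws)
  (hpf : ∀ Y : (ConnectedPart (BTemp Γ))ᵒᵖ, IsPerfFactorial ((DivisorMonoids.ofGaloisActionTempered A hZ).Φ₀.obj Y))
  {D : Type u₀} [Category.{v₀} D] {VD : FrdICatStub.{u₀, v₀, u} D}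

/-- `ofRlfZ` twin of `bΛ_eq_one_of_baseRootLaw_tempered`. [cite: MochizukiEtTh2009, Prop 3.2 (iii) p.70] -/
theorem bΛ_eq_one_of_baseRootLaw_tempered_ofRlfZ
    (tf : TemperedFrobenioid (RealifiedDivisorMonoids.ofRlfZ (DivisorMonoids.ofGaloisActionTempered A hZ) hpf) D VD)
    (IG : D → Prop) (h : tf.BaseRootLaw IG) (X : D) (hX : IG X)
    (b : (RealifiedDivisorMonoids.ofRlfZ (DivisorMonoids.ofGaloisActionTempered A hZ) hpf).BΛ.obj
      (op (tf.base.obj X))) : b = 1 := by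
  apply Subtype.ext
  funext s
  apply Z.eq_one_of_forall_exists_pow_eq
  intro N
  obtain ⟨X', hX', c, b', hb'⟩ := h N X hX b
  exact DivisorMonoids.exists_pow_eq_apply_ofGaloisActionTempered A hZ (tf.base.map c) N b b' hb' s

/-- `ofRlfZ` twin of `not_isIG_of_baseRootLaw_tempered`. [cite: MochizukiEtTh2009, Def 3.6 (ii) p.77] -/
theorem not_isIG_of_baseRootLaw_tempered_ofRlfZ
    (tf : TemperedFrobenioid (RealifiedDivisorMonoids.ofRlfZ (DivisorMonoids.ofGaloisActionTempered A hZ) hpf) D VD)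
    (IG : D → Prop) (h : tf.BaseRootLaw IG) (X : D) : ¬ IG X := by
  intro hX
  obtain ⟨b, -, x, -, y, -, hxy, hdiv⟩ := tf.exists_FΛ_div_ne (op X)
  have hb : b = 1 := bΛ_eq_one_of_baseRootLaw_tempered_ofRlfZ A hZ hpf tf IG h X hX b
  rw [hb, map_one, eq_comm, div_eq_one] at hdiv
  exact hxy ((IsPerfFactorial.Rlf.isIntegral (hpf (op (tf.base.obj X)))).injective_of hdiv)

/-- `ofRlfZ` twin: **A10 REFUTED over the tempered v1 data as soon as one `IG`-object exists.**
[cite: MochizukiEtTh2009, Prop 4.2 (iii) p.89] -/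
theorem not_baseRootLaw_of_exists_tempered_ofRlfZ
    (tf : TemperedFrobenioid (RealifiedDivisorMonoids.ofRlfZ (DivisorMonoids.ofGaloisActionTempered A hZ) hpf) D VD)
    (IG : D → Prop) (hIG : ∃ X : D, IG X) : ¬ tf.BaseRootLaw IG :=
  fun h => hIG.elim fun X hX => not_isIG_of_baseRootLaw_tempered_ofRlfZ A hZ hpf tf IG h X hX

/-- `ofRlfZ` twin for `IG := ⊤`. [cite: MochizukiEtTh2009, Prop 4.2 (iii) p.89] -/
theorem not_baseRootLaw_top_tempered_ofRlfZ
    (tf : TemperedFrobenioid (RealifiedDivisorMonoids.ofRlfZ (DivisorMonoids.ofGaloisActionTempered A hZ) hpf) D VD) :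
    ¬ tf.BaseRootLaw fun _ => True :=
  not_baseRootLaw_of_exists_tempered_ofRlfZ A hZ hpf tf _ ⟨tf.isConnected.is_nonempty.some, trivial⟩

end Strong

end TemperedFrobenioid

end Literature.AnabelianGeometry.EtaleTheta

end
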